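import Mathlib
import HarnessLib

/-!
# Homogeneous parts of bounded Boolean cubics and quartics are bounded — by interpolation certificates

Solo seat `solo-QuantumAdvantage-informed`, session 15, file 35 (§4.32 (1) of the seat's paper
`paper/sharpest-statement.md`; companion of file 34 `SoloInformedMarkovCertificates.lean`, whose noise identity
is reproduced here as private lemmas so that the file is self-contained).

For a multilinear `p(x) = Σ_U c U · x^U` bounded by `1` on `{±1}ⁿ`, the noise identity `flipAverage_abs_le`
(with `S = univ`) says that the NOISE POLYNOMIAL `u ↦ Σ_U c U x^U u^{#U}` is bounded by `1` at
`u = 1 − 2t`, `t ∈ [0,1]`, for every vertex `x`. Extracting the coefficient of `u^k` by Lagrange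
interpolation at rational nodes gives DIMENSION-FREE pointwise bounds on the homogeneous parts
`p^{=k}(x) = Σ_{#U = k} c U x^U`:

* degree `≤ 3`, nodes `u ∈ {1, 1/2, −1/2, −1}`: `|p^{=2}(x)| ≤ 8/3`, `|p^{=3}(x)| ≤ 4`
  (`certificate_deg3_quad/top`, `quadPart_abs_le_deg3`, `cubicPart_abs_le_deg3`); the bound `4` is the
  ingredient of the cube-norm constant `C₃ ≤ (3³/3!)·4 = 18` of THEOREM R (§4.29);
* degree `≤ 4`, nodes `u ∈ {1, 1/2, 0, −1/2, −1}`: `|p^{=1}(x)| ≤ 3`, `|p^{=2}(x)| ≤ 32/3`,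
  `|p^{=3}(x)| ≤ 4`, `|p^{=4}(x)| ≤ 32/3` (`…_deg4`), and `Σ_i |c {i}| ≤ 3` for bounded QUARTICS
  (`linear_coeff_l1_le_deg4`) — the facts (F-lin)₄ and (1) of §4.32 used by THEOREM E₄.

No sharpness is claimed. Trust base: Mathlib only. No definitions.
-/

namespace Summit.QuantumAdvantage.QuantumAdvantage.Theorems

namespace HomogeneousParts

open Finset

variable {n : ℕ}

/-! ## The noise identity (reproduced from file 34 as private lemmas, so that this file
depends on Mathlib only) -/

/-- Flipping the coordinates in `V` multiplies the monomial `x^U` by `(−1)^{#(U ∩ V)}`. -/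
private theorem prod_flip (x : Fin n → ℝ) (U V : Finset (Fin n)) :
    ∏ i ∈ U, (if i ∈ V then -x i else x i) = (-1) ^ (U ∩ V).card * ∏ i ∈ U, x i := by
  have h1 : ∀ i ∈ U, (if i ∈ V then -x i else x i) = (if i ∈ V then (-1:ℝ) else 1) * x i := by
    intro i _
    split_ifs <;> ring
  rw [prod_congr rfl h1, prod_mul_distrib, prod_ite_mem, prod_const]

/-- The polynomial at the flipped point, monomial by monomial. -/
private theorem eval_flip (c : Finset (Fin n) → ℝ) (x : Fin n → ℝ) (V : Finset (Fin n)) :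
    ∑ U : Finset (Fin n), c U * ∏ i ∈ U, (if i ∈ V then -x i else x i)
      = ∑ U : Finset (Fin n), c U * ((-1) ^ (U ∩ V).card * ∏ i ∈ U, x i) := by
  refine sum_congr rfl fun U _ => ?_
  rw [prod_flip]

/-- NOISE IDENTITY (explicit convex combination). Averaging the polynomial over the points obtained
from `x` by flipping each coordinate of `S` independently with probability `t` — written as the
finite sum over the flipped set `V ⊆ S` with weight `t^{#V} (1−t)^{#S−#V}` — gives
`Σ_U c U · x^U · (1 − 2t)^{#(U ∩ S)}`. Valid for all real `x` and `t`. -/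
private theorem flipAverage_eq (c : Finset (Fin n) → ℝ) (x : Fin n → ℝ) (S : Finset (Fin n)) (t : ℝ) :
    ∑ V ∈ S.powerset, t ^ V.card * (1 - t) ^ (S.card - V.card) *
        (∑ U : Finset (Fin n), c U * ∏ i ∈ U, (if i ∈ V then -x i else x i))
      = ∑ U : Finset (Fin n), c U * (∏ i ∈ U, x i) * (1 - 2 * t) ^ (U ∩ S).card := by
  classical
  have key : ∀ U : Finset (Fin n),
      ∑ V ∈ S.powerset, t ^ V.card * (1 - t) ^ (S.card - V.card) * (-1 : ℝ) ^ (U ∩ V).card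
        = (1 - 2 * t) ^ (U ∩ S).card := by
    intro U
    have h : ∏ i ∈ S, (t * (if i ∈ U then (-1:ℝ) else 1) + (1 - t))
        = ∑ V ∈ S.powerset, (∏ i ∈ V, t * (if i ∈ U then (-1:ℝ) else 1)) *
            ∏ i ∈ S \ V, ((1:ℝ) - t) :=
      Finset.prod_add (fun i => t * (if i ∈ U then (-1:ℝ) else 1)) (fun _ => (1:ℝ) - t) S
    have hl : ∏ i ∈ S, (t * (if i ∈ U then (-1:ℝ) else 1) + (1 - t))
        = (1 - 2 * t) ^ (U ∩ S).card := by
      have h2 : ∀ i ∈ S, (t * (if i ∈ U then (-1:ℝ) else 1) + (1 - t))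
          = (if i ∈ U then (1 - 2 * t) else 1) := by
        intro i _
        split_ifs <;> ring
      rw [prod_congr rfl h2, prod_ite_mem, prod_const, inter_comm]
    have hr : ∀ V ∈ S.powerset,
        (∏ i ∈ V, t * (if i ∈ U then (-1:ℝ) else 1)) * ∏ i ∈ S \ V, ((1:ℝ) - t)
          = t ^ V.card * (1 - t) ^ (S.card - V.card) * (-1 : ℝ) ^ (U ∩ V).card := by
      intro V hV
      rw [prod_mul_distrib, prod_const, prod_ite_mem, prod_const, prod_const,
        card_sdiff_of_subset (mem_powerset.1 hV), inter_comm]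
      ring
    rw [← hl, h]
    exact (sum_congr rfl hr).symm
  calc ∑ V ∈ S.powerset, t ^ V.card * (1 - t) ^ (S.card - V.card) *
          (∑ U : Finset (Fin n), c U * ∏ i ∈ U, (if i ∈ V then -x i else x i))
      = ∑ V ∈ S.powerset, ∑ U : Finset (Fin n), t ^ V.card * (1 - t) ^ (S.card - V.card) *
          (c U * ((-1) ^ (U ∩ V).card * ∏ i ∈ U, x i)) := by
        refine sum_congr rfl fun V _ => ?_
        rw [eval_flip, mul_sum]
    _ = ∑ U : Finset (Fin n), ∑ V ∈ S.powerset, t ^ V.card * (1 - t) ^ (S.card - V.card) *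
          (c U * ((-1) ^ (U ∩ V).card * ∏ i ∈ U, x i)) := sum_comm
    _ = ∑ U : Finset (Fin n), c U * (∏ i ∈ U, x i) * (1 - 2 * t) ^ (U ∩ S).card := by
        refine sum_congr rfl fun U _ => ?_
        rw [← key U, mul_sum]
        refine sum_congr rfl fun V _ => ?_
        ring

/-- A flipped sign vector is a sign vector. -/
private theorem flip_sign {x : Fin n → ℝ} (hx : ∀ i, x i = 1 ∨ x i = -1) (V : Finset (Fin n)) :
    ∀ i, (fun j => if j ∈ V then -x j else x j) i = 1 ∨
      (fun j => if j ∈ V then -x j else x j) i = -1 := by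
  intro i
  rcases hx i with h | h <;> by_cases hi : i ∈ V <;> simp [hi, h]

/-- The noise average of a bounded polynomial is bounded: for `t ∈ [0,1]`,
`|Σ_U c U x^U (1 − 2t)^{#(U ∩ S)}| ≤ 1` (it is a convex combination of values at vertices). -/
private theorem flipAverage_abs_le (c : Finset (Fin n) → ℝ) (x : Fin n → ℝ)
    (hx : ∀ i, x i = 1 ∨ x i = -1)
    (hb : ∀ y : Fin n → ℝ, (∀ i, y i = 1 ∨ y i = -1) →
      |∑ U : Finset (Fin n), c U * ∏ i ∈ U, y i| ≤ 1)
    (S : Finset (Fin n)) (t : ℝ) (ht0 : 0 ≤ t) (ht1 : t ≤ 1) :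
    |∑ U : Finset (Fin n), c U * (∏ i ∈ U, x i) * (1 - 2 * t) ^ (U ∩ S).card| ≤ 1 := by
  classical
  rw [← flipAverage_eq]
  have h1t : 0 ≤ 1 - t := sub_nonneg.2 ht1
  calc |∑ V ∈ S.powerset, t ^ V.card * (1 - t) ^ (S.card - V.card) *
          (∑ U : Finset (Fin n), c U * ∏ i ∈ U, (if i ∈ V then -x i else x i))|
      ≤ ∑ V ∈ S.powerset, |t ^ V.card * (1 - t) ^ (S.card - V.card) *
          (∑ U : Finset (Fin n), c U * ∏ i ∈ U, (if i ∈ V then -x i else x i))| :=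
        abs_sum_le_sum_abs _ _
    _ ≤ ∑ V ∈ S.powerset, t ^ V.card * (1 - t) ^ (S.card - V.card) := by
        refine sum_le_sum fun V _ => ?_
        have hw : 0 ≤ t ^ V.card * (1 - t) ^ (S.card - V.card) :=
          mul_nonneg (pow_nonneg ht0 _) (pow_nonneg h1t _)
        rw [abs_mul, abs_of_nonneg hw]
        exact mul_le_of_le_one_right hw (hb _ (flip_sign hx V))
    _ = (t + (1 - t)) ^ S.card := sum_pow_mul_eq_add_pow _ _ _
    _ = 1 := by rw [show t + (1 - t) = (1:ℝ) by ring, one_pow]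

/-! ## Two arithmetic certificates (kept separate so that `linarith` sees only scalars) -/

/-- The noise polynomial of `c` at the vertex `x` and noise rate `t` (the normal form of `flipAverage_abs_le` with `S = univ`). -/
private theorem noise_abs_le (c : Finset (Fin n) → ℝ) (x : Fin n → ℝ)
    (hx : ∀ i, x i = 1 ∨ x i = -1)
    (hb : ∀ y : Fin n → ℝ, (∀ i, y i = 1 ∨ y i = -1) →
      |∑ U : Finset (Fin n), c U * ∏ i ∈ U, y i| ≤ 1)
    (t : ℝ) (ht0 : 0 ≤ t) (ht1 : t ≤ 1) :
    |∑ U : Finset (Fin n), c U * (∏ i ∈ U, x i) * (1 - 2 * t) ^ U.card| ≤ 1 := by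
  classical
  have h := flipAverage_abs_le c x hx hb univ t ht0 ht1
  simpa only [inter_univ] using h

/-! ## Degree ≤ 3: four nodes `u = 1, 1/2, −1/2, −1` (`t = 0, 1/4, 3/4, 1`) -/

/-- `[k = 3] = (2/3)·1 − (4/3)(1/2)^k + (4/3)(−1/2)^k − (2/3)(−1)^k` for `k ≤ 3`. -/
theorem certificate_deg3_top (c : Finset (Fin n) → ℝ) (hdeg : ∀ U, c U ≠ 0 → U.card ≤ 3)
    (x : Fin n → ℝ) :
    ∑ U : Finset (Fin n), (if U.card = 3 then c U * ∏ j ∈ U, x j else 0)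
      = 2 / 3 * (∑ U : Finset (Fin n), c U * (∏ j ∈ U, x j) * (1 - 2 * (0:ℝ)) ^ U.card)
        - 4 / 3 * (∑ U : Finset (Fin n), c U * (∏ j ∈ U, x j) * (1 - 2 * (1/4:ℝ)) ^ U.card)
        + 4 / 3 * (∑ U : Finset (Fin n), c U * (∏ j ∈ U, x j) * (1 - 2 * (3/4:ℝ)) ^ U.card)
        - 2 / 3 * (∑ U : Finset (Fin n), c U * (∏ j ∈ U, x j) * (1 - 2 * (1:ℝ)) ^ U.card) := by
  classical
  rw [mul_sum, mul_sum, mul_sum, mul_sum, ← sum_sub_distrib, ← sum_add_distrib, ← sum_sub_distrib]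
  refine sum_congr rfl fun U _ => ?_
  by_cases hc : c U = 0
  · simp [hc]
  · have hk : U.card ≤ 3 := hdeg U hc
    generalize U.card = k at hk ⊢
    rcases (show k = 0 ∨ k = 1 ∨ k = 2 ∨ k = 3 by omega) with rfl | rfl | rfl | rfl
    · norm_num
    · norm_num
      ring
    · norm_num
    · norm_num
      ring

/-- `[k = 2] = (2/3)·1 − (2/3)(1/2)^k − (2/3)(−1/2)^k + (2/3)(−1)^k` for `k ≤ 3`. -/
theorem certificate_deg3_quad (c : Finset (Fin n) → ℝ) (hdeg : ∀ U, c U ≠ 0 → U.card ≤ 3)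
    (x : Fin n → ℝ) :
    ∑ U : Finset (Fin n), (if U.card = 2 then c U * ∏ j ∈ U, x j else 0)
      = 2 / 3 * (∑ U : Finset (Fin n), c U * (∏ j ∈ U, x j) * (1 - 2 * (0:ℝ)) ^ U.card)
        - 2 / 3 * (∑ U : Finset (Fin n), c U * (∏ j ∈ U, x j) * (1 - 2 * (1/4:ℝ)) ^ U.card)
        - 2 / 3 * (∑ U : Finset (Fin n), c U * (∏ j ∈ U, x j) * (1 - 2 * (3/4:ℝ)) ^ U.card)
        + 2 / 3 * (∑ U : Finset (Fin n), c U * (∏ j ∈ U, x j) * (1 - 2 * (1:ℝ)) ^ U.card) := by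
  classical
  rw [mul_sum, mul_sum, mul_sum, mul_sum, ← sum_sub_distrib, ← sum_sub_distrib, ← sum_add_distrib]
  refine sum_congr rfl fun U _ => ?_
  by_cases hc : c U = 0
  · simp [hc]
  · have hk : U.card ≤ 3 := hdeg U hc
    generalize U.card = k at hk ⊢
    rcases (show k = 0 ∨ k = 1 ∨ k = 2 ∨ k = 3 by omega) with rfl | rfl | rfl | rfl
    · norm_num
    · norm_num
    · norm_num
      ring
    · norm_num

/-- Four values of modulus `≤ 1` combined with weights `2/3, −4/3, 4/3, −2/3` give modulus `≤ 4`. -/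
theorem deg3_top_arith {E₀ E₁ E₂ E₃ : ℝ} (h₀ : |E₀| ≤ 1) (h₁ : |E₁| ≤ 1) (h₂ : |E₂| ≤ 1)
    (h₃ : |E₃| ≤ 1) : |2 / 3 * E₀ - 4 / 3 * E₁ + 4 / 3 * E₂ - 2 / 3 * E₃| ≤ 4 := by
  rw [abs_le] at h₀ h₁ h₂ h₃ ⊢
  constructor <;> linarith [h₀.1, h₀.2, h₁.1, h₁.2, h₂.1, h₂.2, h₃.1, h₃.2]

/-- Four values of modulus `≤ 1` combined with weights `±2/3` give modulus `≤ 8/3`. -/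
theorem deg3_quad_arith {E₀ E₁ E₂ E₃ : ℝ} (h₀ : |E₀| ≤ 1) (h₁ : |E₁| ≤ 1) (h₂ : |E₂| ≤ 1)
    (h₃ : |E₃| ≤ 1) : |2 / 3 * E₀ - 2 / 3 * E₁ - 2 / 3 * E₂ + 2 / 3 * E₃| ≤ 8 / 3 := by
  rw [abs_le] at h₀ h₁ h₂ h₃ ⊢
  constructor <;> linarith [h₀.1, h₀.2, h₁.1, h₁.2, h₂.1, h₂.2, h₃.1, h₃.2]

/-- THE CUBIC PART OF A BOUNDED CUBIC IS AT MOST `4` AT EVERY VERTEX. -/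
theorem cubicPart_abs_le_deg3 (c : Finset (Fin n) → ℝ) (hdeg : ∀ U, c U ≠ 0 → U.card ≤ 3)
    (hb : ∀ y : Fin n → ℝ, (∀ i, y i = 1 ∨ y i = -1) →
      |∑ U : Finset (Fin n), c U * ∏ i ∈ U, y i| ≤ 1)
    (x : Fin n → ℝ) (hx : ∀ i, x i = 1 ∨ x i = -1) :
    |∑ U : Finset (Fin n), (if U.card = 3 then c U * ∏ j ∈ U, x j else 0)| ≤ 4 := by
  rw [certificate_deg3_top c hdeg x]
  exact deg3_top_arith (noise_abs_le c x hx hb 0 le_rfl zero_le_one)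
    (noise_abs_le c x hx hb (1/4) (by norm_num) (by norm_num))
    (noise_abs_le c x hx hb (3/4) (by norm_num) (by norm_num))
    (noise_abs_le c x hx hb 1 zero_le_one le_rfl)

/-- THE QUADRATIC PART OF A BOUNDED CUBIC IS AT MOST `8/3` AT EVERY VERTEX. -/
theorem quadPart_abs_le_deg3 (c : Finset (Fin n) → ℝ) (hdeg : ∀ U, c U ≠ 0 → U.card ≤ 3)
    (hb : ∀ y : Fin n → ℝ, (∀ i, y i = 1 ∨ y i = -1) →
      |∑ U : Finset (Fin n), c U * ∏ i ∈ U, y i| ≤ 1)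
    (x : Fin n → ℝ) (hx : ∀ i, x i = 1 ∨ x i = -1) :
    |∑ U : Finset (Fin n), (if U.card = 2 then c U * ∏ j ∈ U, x j else 0)| ≤ 8 / 3 := by
  rw [certificate_deg3_quad c hdeg x]
  exact deg3_quad_arith (noise_abs_le c x hx hb 0 le_rfl zero_le_one)
    (noise_abs_le c x hx hb (1/4) (by norm_num) (by norm_num))
    (noise_abs_le c x hx hb (3/4) (by norm_num) (by norm_num))
    (noise_abs_le c x hx hb 1 zero_le_one le_rfl)

/-! ## Degree ≤ 4: five nodes `u = 1, 1/2, 0, −1/2, −1` (`t = 0, 1/4, 1/2, 3/4, 1`) -/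

/-- The five-node extraction certificates for `k ≤ 4`:
`[k=1] = −(1/6)·1 + (4/3)(1/2)^k − (4/3)(−1/2)^k + (1/6)(−1)^k`,
`[k=2] = −(1/6)·1 + (8/3)(1/2)^k − 5·0^k + (8/3)(−1/2)^k − (1/6)(−1)^k`,
`[k=3] = (2/3)·1 − (4/3)(1/2)^k + (4/3)(−1/2)^k − (2/3)(−1)^k`,
`[k=4] = (2/3)·1 − (8/3)(1/2)^k + 4·0^k − (8/3)(−1/2)^k + (2/3)(−1)^k`,
packaged as one statement about an arbitrary weight vector. -/
theorem certificate_deg4 (c : Finset (Fin n) → ℝ) (hdeg : ∀ U, c U ≠ 0 → U.card ≤ 4)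
    (x : Fin n → ℝ) (k : ℕ) (a₀ a₁ a₂ a₃ a₄ : ℝ)
    (hcert : ∀ j : ℕ, j ≤ 4 →
      (if j = k then (1:ℝ) else 0)
        = a₀ * (1 - 2 * (0:ℝ)) ^ j + a₁ * (1 - 2 * (1/4:ℝ)) ^ j + a₂ * (1 - 2 * (1/2:ℝ)) ^ j
          + a₃ * (1 - 2 * (3/4:ℝ)) ^ j + a₄ * (1 - 2 * (1:ℝ)) ^ j) :
    ∑ U : Finset (Fin n), (if U.card = k then c U * ∏ j ∈ U, x j else 0)
      = a₀ * (∑ U : Finset (Fin n), c U * (∏ j ∈ U, x j) * (1 - 2 * (0:ℝ)) ^ U.card)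
        + a₁ * (∑ U : Finset (Fin n), c U * (∏ j ∈ U, x j) * (1 - 2 * (1/4:ℝ)) ^ U.card)
        + a₂ * (∑ U : Finset (Fin n), c U * (∏ j ∈ U, x j) * (1 - 2 * (1/2:ℝ)) ^ U.card)
        + a₃ * (∑ U : Finset (Fin n), c U * (∏ j ∈ U, x j) * (1 - 2 * (3/4:ℝ)) ^ U.card)
        + a₄ * (∑ U : Finset (Fin n), c U * (∏ j ∈ U, x j) * (1 - 2 * (1:ℝ)) ^ U.card) := by
  classical
  rw [mul_sum, mul_sum, mul_sum, mul_sum, mul_sum, ← sum_add_distrib, ← sum_add_distrib,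
    ← sum_add_distrib, ← sum_add_distrib]
  refine sum_congr rfl fun U _ => ?_
  by_cases hc : c U = 0
  · simp [hc]
  · have hk : U.card ≤ 4 := hdeg U hc
    have h := hcert U.card hk
    have e : (if U.card = k then c U * ∏ j ∈ U, x j else 0)
        = (c U * ∏ j ∈ U, x j) * (if U.card = k then (1:ℝ) else 0) := by
      split_ifs <;> simp
    rw [e, h]
    ring

/-- Five values of modulus `≤ 1` combined with weights of total absolute sum `≤ B` give modulus `≤ B`. -/
theorem deg4_arith {E₀ E₁ E₂ E₃ E₄ a₀ a₁ a₂ a₃ a₄ B : ℝ} (h₀ : |E₀| ≤ 1) (h₁ : |E₁| ≤ 1)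
    (h₂ : |E₂| ≤ 1) (h₃ : |E₃| ≤ 1) (h₄ : |E₄| ≤ 1)
    (hB : |a₀| + |a₁| + |a₂| + |a₃| + |a₄| ≤ B) :
    |a₀ * E₀ + a₁ * E₁ + a₂ * E₂ + a₃ * E₃ + a₄ * E₄| ≤ B := by
  have t0 : |a₀ * E₀| ≤ |a₀| := by
    rw [abs_mul]; exact mul_le_of_le_one_right (abs_nonneg _) h₀
  have t1 : |a₁ * E₁| ≤ |a₁| := by
    rw [abs_mul]; exact mul_le_of_le_one_right (abs_nonneg _) h₁
  have t2 : |a₂ * E₂| ≤ |a₂| := by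
    rw [abs_mul]; exact mul_le_of_le_one_right (abs_nonneg _) h₂
  have t3 : |a₃ * E₃| ≤ |a₃| := by
    rw [abs_mul]; exact mul_le_of_le_one_right (abs_nonneg _) h₃
  have t4 : |a₄ * E₄| ≤ |a₄| := by
    rw [abs_mul]; exact mul_le_of_le_one_right (abs_nonneg _) h₄
  calc |a₀ * E₀ + a₁ * E₁ + a₂ * E₂ + a₃ * E₃ + a₄ * E₄|
      ≤ |a₀ * E₀| + |a₁ * E₁| + |a₂ * E₂| + |a₃ * E₃| + |a₄ * E₄| := by
        have := abs_add_le (a₀ * E₀ + a₁ * E₁ + a₂ * E₂ + a₃ * E₃) (a₄ * E₄)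
        have := abs_add_le (a₀ * E₀ + a₁ * E₁ + a₂ * E₂) (a₃ * E₃)
        have := abs_add_le (a₀ * E₀ + a₁ * E₁) (a₂ * E₂)
        have := abs_add_le (a₀ * E₀) (a₁ * E₁)
        linarith
    _ ≤ |a₀| + |a₁| + |a₂| + |a₃| + |a₄| := by linarith
    _ ≤ B := hB

/-- Generic five-node bound: a certificate with absolute weight sum `≤ B` bounds the `k`-th
homogeneous part of a bounded quartic by `B` at every vertex. -/
theorem homPart_abs_le_deg4 (c : Finset (Fin n) → ℝ) (hdeg : ∀ U, c U ≠ 0 → U.card ≤ 4)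
    (hb : ∀ y : Fin n → ℝ, (∀ i, y i = 1 ∨ y i = -1) →
      |∑ U : Finset (Fin n), c U * ∏ i ∈ U, y i| ≤ 1)
    (x : Fin n → ℝ) (hx : ∀ i, x i = 1 ∨ x i = -1) (k : ℕ) (a₀ a₁ a₂ a₃ a₄ B : ℝ)
    (hcert : ∀ j : ℕ, j ≤ 4 →
      (if j = k then (1:ℝ) else 0)
        = a₀ * (1 - 2 * (0:ℝ)) ^ j + a₁ * (1 - 2 * (1/4:ℝ)) ^ j + a₂ * (1 - 2 * (1/2:ℝ)) ^ j
          + a₃ * (1 - 2 * (3/4:ℝ)) ^ j + a₄ * (1 - 2 * (1:ℝ)) ^ j)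
    (hB : |a₀| + |a₁| + |a₂| + |a₃| + |a₄| ≤ B) :
    |∑ U : Finset (Fin n), (if U.card = k then c U * ∏ j ∈ U, x j else 0)| ≤ B := by
  rw [certificate_deg4 c hdeg x k a₀ a₁ a₂ a₃ a₄ hcert]
  exact deg4_arith (noise_abs_le c x hx hb 0 le_rfl zero_le_one)
    (noise_abs_le c x hx hb (1/4) (by norm_num) (by norm_num))
    (noise_abs_le c x hx hb (1/2) (by norm_num) (by norm_num))
    (noise_abs_le c x hx hb (3/4) (by norm_num) (by norm_num))
    (noise_abs_le c x hx hb 1 zero_le_one le_rfl) hB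

/-- Case split for `j ≤ 4`. -/
private theorem cases4 {j : ℕ} (hj : j ≤ 4) : j = 0 ∨ j = 1 ∨ j = 2 ∨ j = 3 ∨ j = 4 := by omega

/-- THE LINEAR PART OF A BOUNDED QUARTIC IS AT MOST `3` AT EVERY VERTEX. -/
theorem linPart_abs_le_deg4 (c : Finset (Fin n) → ℝ) (hdeg : ∀ U, c U ≠ 0 → U.card ≤ 4)
    (hb : ∀ y : Fin n → ℝ, (∀ i, y i = 1 ∨ y i = -1) →
      |∑ U : Finset (Fin n), c U * ∏ i ∈ U, y i| ≤ 1)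
    (x : Fin n → ℝ) (hx : ∀ i, x i = 1 ∨ x i = -1) :
    |∑ U : Finset (Fin n), (if U.card = 1 then c U * ∏ j ∈ U, x j else 0)| ≤ 3 := by
  refine homPart_abs_le_deg4 c hdeg hb x hx 1 (-1/6) (4/3) 0 (-4/3) (1/6) 3 ?_ (by norm_num)
  intro j hj
  rcases cases4 hj with rfl | rfl | rfl | rfl | rfl <;> norm_num

/-- THE QUADRATIC PART OF A BOUNDED QUARTIC IS AT MOST `32/3` AT EVERY VERTEX. -/
theorem quadPart_abs_le_deg4 (c : Finset (Fin n) → ℝ) (hdeg : ∀ U, c U ≠ 0 → U.card ≤ 4)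
    (hb : ∀ y : Fin n → ℝ, (∀ i, y i = 1 ∨ y i = -1) →
      |∑ U : Finset (Fin n), c U * ∏ i ∈ U, y i| ≤ 1)
    (x : Fin n → ℝ) (hx : ∀ i, x i = 1 ∨ x i = -1) :
    |∑ U : Finset (Fin n), (if U.card = 2 then c U * ∏ j ∈ U, x j else 0)| ≤ 32 / 3 := by
  refine homPart_abs_le_deg4 c hdeg hb x hx 2 (-1/6) (8/3) (-5) (8/3) (-1/6) (32/3) ?_ (by norm_num)
  intro j hj
  rcases cases4 hj with rfl | rfl | rfl | rfl | rfl <;> norm_num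

/-- THE CUBIC PART OF A BOUNDED QUARTIC IS AT MOST `4` AT EVERY VERTEX. -/
theorem cubicPart_abs_le_deg4 (c : Finset (Fin n) → ℝ) (hdeg : ∀ U, c U ≠ 0 → U.card ≤ 4)
    (hb : ∀ y : Fin n → ℝ, (∀ i, y i = 1 ∨ y i = -1) →
      |∑ U : Finset (Fin n), c U * ∏ i ∈ U, y i| ≤ 1)
    (x : Fin n → ℝ) (hx : ∀ i, x i = 1 ∨ x i = -1) :
    |∑ U : Finset (Fin n), (if U.card = 3 then c U * ∏ j ∈ U, x j else 0)| ≤ 4 := by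
  refine homPart_abs_le_deg4 c hdeg hb x hx 3 (2/3) (-4/3) 0 (4/3) (-2/3) 4 ?_ (by norm_num)
  intro j hj
  rcases cases4 hj with rfl | rfl | rfl | rfl | rfl <;> norm_num

/-- THE QUARTIC PART OF A BOUNDED QUARTIC IS AT MOST `32/3` AT EVERY VERTEX. -/
theorem quarticPart_abs_le_deg4 (c : Finset (Fin n) → ℝ) (hdeg : ∀ U, c U ≠ 0 → U.card ≤ 4)
    (hb : ∀ y : Fin n → ℝ, (∀ i, y i = 1 ∨ y i = -1) →
      |∑ U : Finset (Fin n), c U * ∏ i ∈ U, y i| ≤ 1)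
    (x : Fin n → ℝ) (hx : ∀ i, x i = 1 ∨ x i = -1) :
    |∑ U : Finset (Fin n), (if U.card = 4 then c U * ∏ j ∈ U, x j else 0)| ≤ 32 / 3 := by
  refine homPart_abs_le_deg4 c hdeg hb x hx 4 (2/3) (-8/3) 4 (-8/3) (2/3) (32/3) ?_ (by norm_num)
  intro j hj
  rcases cases4 hj with rfl | rfl | rfl | rfl | rfl <;> norm_num

/-- (F-lin)₄: THE DEGREE-ONE COEFFICIENTS OF A BOUNDED QUARTIC HAVE `ℓ₁`-NORM AT MOST `3`. -/
theorem linear_coeff_l1_le_deg4 (c : Finset (Fin n) → ℝ) (hdeg : ∀ U, c U ≠ 0 → U.card ≤ 4)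
    (hb : ∀ y : Fin n → ℝ, (∀ i, y i = 1 ∨ y i = -1) →
      |∑ U : Finset (Fin n), c U * ∏ i ∈ U, y i| ≤ 1) :
    ∑ i : Fin n, |c {i}| ≤ 3 := by
  classical
  set s : Fin n → ℝ := fun i => if 0 ≤ c {i} then (1:ℝ) else -1 with hs
  have hsgn : ∀ i, s i = 1 ∨ s i = -1 := by
    intro i
    by_cases h : 0 ≤ c {i} <;> simp [hs, h]
  have h1 : ∀ i : Fin n, |c {i}| = c {i} * ∏ j ∈ ({i} : Finset (Fin n)), s j := by
    intro i
    rw [prod_singleton]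
    by_cases h : 0 ≤ c {i}
    · simp [hs, h, abs_of_nonneg h]
    · simp [hs, h, abs_of_neg (lt_of_not_ge h)]
  have hsing : ∑ i : Fin n, |c {i}|
      = ∑ U : Finset (Fin n), (if U.card = 1 then c U * ∏ j ∈ U, s j else 0) := by
    calc ∑ i : Fin n, |c {i}|
        = ∑ i : Fin n, c {i} * ∏ j ∈ ({i} : Finset (Fin n)), s j := sum_congr rfl fun i _ => h1 i
      _ = ∑ i : Fin n, ∑ U : Finset (Fin n), (if U = {i} then c U * ∏ j ∈ U, s j else 0) := by
          refine sum_congr rfl fun i _ => ?_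
          rw [Fintype.sum_ite_eq' ({i} : Finset (Fin n)) (fun U => c U * ∏ j ∈ U, s j)]
      _ = ∑ U : Finset (Fin n), ∑ i : Fin n, (if U = {i} then c U * ∏ j ∈ U, s j else 0) :=
          sum_comm
      _ = ∑ U : Finset (Fin n), (if U.card = 1 then c U * ∏ j ∈ U, s j else 0) := by
          refine sum_congr rfl fun U _ => ?_
          by_cases hU : U.card = 1
          · obtain ⟨a, rfl⟩ := card_eq_one.1 hU
            rw [if_pos hU]
            simp only [singleton_inj]
            rw [Fintype.sum_ite_eq]
          · have hne : ∀ i : Fin n, U ≠ {i} := fun i h => hU (by rw [h, card_singleton])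
            simp [hne, hU]
  rw [hsing]
  exact (abs_le.1 (linPart_abs_le_deg4 c hdeg hb s hsgn)).2

end HomogeneousParts

end Summit.QuantumAdvantage.QuantumAdvantage.Theorems
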